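import Literature.Probability.Percolation.SlabRSWGluingSegExtB
import HarnessLib

/-!
# Newman–Tassion–Wu 2017, §3.2 / §3.4 — the gluing lemma in an L-SHAPED domain `R = S ∪ V`
# (`S` a rectangle carrying `Γ`, `V` a lobe under its left end): setting and the plain surgery
# from PORT DATA, including ports in the lobe

Topic: `Literature/Probability/Percolation`. Theorem 3.10 of NTW (open circuits in annuli with
positive probability) glues crossings of L-shaped regions `S₁ = H-arm ∪ V-arm` ((3.65)–(3.70)); the
natural gluing datum is `S = H⁺` (the maximal horizontal rectangle of the L, where `Γ` lives),
`R = H⁺ ∪ V⁻` (the lobe `V⁻` under the left end of `H⁺`), `A` = right side of `H⁺`, `B` = left side of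
`H⁺`, `C` = bottom of the lobe. The local geometry is new at the inner corner of the L: the cleared box
`(z + B_r) ∩ R` is L-shaped when the port of the far path lies in the lobe while the vertices of `Γ` lie
in `H⁺`. This file: the setting `LobeSetup` and the plain surgery (box off the column of `B`, no cell of
`A` nearby) from port data in both sub-cases — port over the trunk box `(z + B_r) ∩ S` (the tree's
`exists_route`), or port in the lobe: route to an anchor on the bottom row of the trunk box and append
the exterior L-path through the lobe (`RouteSpec.append_branch`, as in the lead's
`exists_surgeryB_ext_at`).

* `LobeSetup`, `LobeSetup.Q`, `exists_surgery_lobe_at_S`, `exists_surgery_lobe_at_R`.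

## Sources

* C. M. Newman, V. Tassion, G. Wu, *Critical percolation and the minimal spanning tree in slabs*,
  Comm. Pure Appl. Math. 70 (2017), arXiv:1512.09107: §3.2 (Theorem 3.7, proof, steps (1)–(3); Remark 2
  on rectilinear domains), §3.4 (proof of Theorem 3.10, the regions S₁, S₁′, (3.65)) [NewmanTassionWu2017].
-/

noncomputable section

namespace Literature.Probability.Percolation

open MeasureTheory LatticeModels SimpleGraph

namespace NTW17

variable {k : ℕ}

/-! ## The setting -/

/-- **GL in an L-shaped domain**: `S = [a,b] × [c,d]` (the rectangle of the minimal path, at least four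
columns and rows), the lobe `V = [a,a'] × [c',c-1]` under its left end (`a ≤ a' < b`), `R = S ∪ V`;
target `B = {a} × [c,d]` (the left side of `S`), `A ⊆ S` off the column `a`, `C ⊆ R`.
[cite: NewmanTassionWu2017, §3.4 (proof of Theorem 3.10, the L-shaped regions S₁, S₁′)] -/
structure LobeSetup where
  /-- left column of `S` and of the lobe -/
  a : ℤ
  /-- right column of `S` -/
  b : ℤ
  /-- bottom row of `S` -/
  c : ℤ
  /-- top row of `S` -/
  d : ℤ
  /-- right column of the lobe -/
  a' : ℤ
  /-- bottom row of the lobe -/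
  c' : ℤ
  /-- the set to be reached -/
  A : Set (ℤ × ℤ)
  /-- the set to be glued -/
  C : Set (ℤ × ℤ)
  hab : a + 3 ≤ b
  hcd : c + 3 ≤ d
  haa' : a ≤ a'
  ha'b : a' < b
  hA : A ⊆ boxR a b c d
  hAB : ∀ z ∈ A, z.1 ≠ a
  hC : C ⊆ boxR a b c d ∪ boxR a a' c' (c - 1)

namespace LobeSetup

variable (G : LobeSetup)

/-- The rectangle `S` (domain of the minimal path). [cite: NewmanTassionWu2017, §3.4 (proof of Theorem 3.10)] -/
def S : Set (ℤ × ℤ) := boxR G.a G.b G.c G.d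

/-- The lobe `V` under the left end of `S`. [cite: NewmanTassionWu2017, §3.4 (proof of Theorem 3.10, the vertical arm)] -/
def V : Set (ℤ × ℤ) := boxR G.a G.a' G.c' (G.c - 1)

/-- The L-shaped domain `R = S ∪ V`. [cite: NewmanTassionWu2017, §3.4 (proof of Theorem 3.10, S₁)] -/
def R : Set (ℤ × ℤ) := G.S ∪ G.V

/-- The target `B = {a} × [c,d]` (left side of `S`). [cite: NewmanTassionWu2017, §3.4 (proof of Theorem 3.10)] -/
def B : Set (ℤ × ℤ) := {z | z ∈ G.S ∧ z.1 = G.a}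

/-- `S ⊆ R`. [cite: NewmanTassionWu2017, §3.4 (proof of Theorem 3.10)] -/
theorem S_subset_R : G.S ⊆ G.R := Set.subset_union_left

/-- `V ⊆ R`. [cite: NewmanTassionWu2017, §3.4 (proof of Theorem 3.10)] -/
theorem V_subset_R : G.V ⊆ G.R := Set.subset_union_right

/-- `R` is finite. [cite: NewmanTassionWu2017, §3.4 (proof of Theorem 3.10)] -/
theorem R_finite : G.R.Finite := (boxR_finite _ _ _ _).union (boxR_finite _ _ _ _)

/-- The gluing data `(S, R, A, B, C)`. [cite: NewmanTassionWu2017, §3.2 (Theorem 3.7), §3.4] -/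
def Q : GlueData := ⟨G.S, G.R, G.A, G.B, G.C, G.S_subset_R, boxR_finite _ _ _ _, G.R_finite⟩

/-- The trunk box `(z + B_r) ∩ S`. [cite: NewmanTassionWu2017, §3.2 (proof of Theorem 3.7, the ball B_{r+1}(z) ∩ S)] -/
def DS (z : ℤ × ℤ) (r : ℕ) : Set (ℤ × ℤ) :=
  boxR (max G.a (z.1 - r)) (min G.b (z.1 + r)) (max G.c (z.2 - r)) (min G.d (z.2 + r))

/-- The lobe part `(z + B_r) ∩ V` of the cleared box. [cite: NewmanTassionWu2017, §3.2 (proof of Theorem 3.7)] -/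
def DV (z : ℤ × ℤ) (r : ℕ) : Set (ℤ × ℤ) :=
  boxR (max G.a (z.1 - r)) (min G.a' (z.1 + r)) (max G.c' (z.2 - r)) (min (G.c - 1) (z.2 + r))

/-- The full cleared box `(z + B_r) ∩ R` (possibly L-shaped). [cite: NewmanTassionWu2017, §3.2 (proof of Theorem 3.7, the ball B_{r+2}(z))] -/
def DR (z : ℤ × ℤ) (r : ℕ) : Set (ℤ × ℤ) := G.DS z r ∪ G.DV z r

variable {G}

/-- Membership in `S`. [cite: NewmanTassionWu2017, §3.4 (proof of Theorem 3.10)] -/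
theorem mem_S_iff {z : ℤ × ℤ} : z ∈ G.S ↔ G.a ≤ z.1 ∧ z.1 ≤ G.b ∧ G.c ≤ z.2 ∧ z.2 ≤ G.d :=
  mem_boxR_iff z

/-- Membership in `V`. [cite: NewmanTassionWu2017, §3.4 (proof of Theorem 3.10)] -/
theorem mem_V_iff {z : ℤ × ℤ} : z ∈ G.V ↔ G.a ≤ z.1 ∧ z.1 ≤ G.a' ∧ G.c' ≤ z.2 ∧ z.2 ≤ G.c - 1 :=
  mem_boxR_iff z

/-- Membership in `R`. [cite: NewmanTassionWu2017, §3.4 (proof of Theorem 3.10)] -/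
theorem mem_R_iff {z : ℤ × ℤ} : z ∈ G.R ↔ z ∈ G.S ∨ z ∈ G.V := Iff.rfl

/-- Membership in `B`. [cite: NewmanTassionWu2017, §3.4 (proof of Theorem 3.10)] -/
theorem mem_B_iff {z : ℤ × ℤ} : z ∈ G.B ↔ z ∈ G.S ∧ z.1 = G.a := Iff.rfl

/-- Membership in `DS`. [cite: NewmanTassionWu2017, §3.2 (proof of Theorem 3.7)] -/
theorem mem_DS_iff {z w : ℤ × ℤ} {r : ℕ} : w ∈ G.DS z r ↔ w ∈ G.S ∧ w ∈ sqBox z r := by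
  rw [DS, mem_boxR_iff, mem_S_iff, mem_sqBox_iff']
  simp only [max_le_iff, le_min_iff]
  omega

/-- Membership in `DV`. [cite: NewmanTassionWu2017, §3.2 (proof of Theorem 3.7)] -/
theorem mem_DV_iff {z w : ℤ × ℤ} {r : ℕ} : w ∈ G.DV z r ↔ w ∈ G.V ∧ w ∈ sqBox z r := by
  rw [DV, mem_boxR_iff, mem_V_iff, mem_sqBox_iff']
  simp only [max_le_iff, le_min_iff]
  omega

/-- Membership in `DR`. [cite: NewmanTassionWu2017, §3.2 (proof of Theorem 3.7)] -/
theorem mem_DR_iff {z w : ℤ × ℤ} {r : ℕ} : w ∈ G.DR z r ↔ w ∈ G.R ∧ w ∈ sqBox z r := by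
  rw [DR, Set.mem_union, mem_DS_iff, mem_DV_iff, mem_R_iff]
  tauto

/-- `DS ⊆ S`. [cite: NewmanTassionWu2017, §3.2 (proof of Theorem 3.7)] -/
theorem DS_subset_S (z : ℤ × ℤ) (r : ℕ) : G.DS z r ⊆ G.S := fun _ h => (mem_DS_iff.1 h).1

/-- `DS ⊆ z + B_r`. [cite: NewmanTassionWu2017, §3.2 (proof of Theorem 3.7)] -/
theorem DS_subset_sqBox (z : ℤ × ℤ) (r : ℕ) : G.DS z r ⊆ sqBox z r := fun _ h => (mem_DS_iff.1 h).2

/-- `DS ⊆ DR`. [cite: NewmanTassionWu2017, §3.2 (proof of Theorem 3.7)] -/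
theorem DS_subset_DR (z : ℤ × ℤ) (r : ℕ) : G.DS z r ⊆ G.DR z r := Set.subset_union_left

/-- `DV ⊆ DR`. [cite: NewmanTassionWu2017, §3.2 (proof of Theorem 3.7)] -/
theorem DV_subset_DR (z : ℤ × ℤ) (r : ℕ) : G.DV z r ⊆ G.DR z r := Set.subset_union_right

/-- `DR ⊆ R`. [cite: NewmanTassionWu2017, §3.2 (proof of Theorem 3.7)] -/
theorem DR_subset_R (z : ℤ × ℤ) (r : ℕ) : G.DR z r ⊆ G.R := fun _ h => (mem_DR_iff.1 h).1

/-- `DR ⊆ z + B_r`. [cite: NewmanTassionWu2017, §3.2 (proof of Theorem 3.7)] -/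
theorem DR_subset_sqBox (z : ℤ × ℤ) (r : ℕ) : G.DR z r ⊆ sqBox z r := fun _ h => (mem_DR_iff.1 h).2

/-- `Q.S = S`. [cite: NewmanTassionWu2017, §3.2 (Theorem 3.7)] -/
theorem Q_S : G.Q.S = G.S := rfl
/-- `Q.R = R`. [cite: NewmanTassionWu2017, §3.2 (Theorem 3.7)] -/
theorem Q_R : G.Q.R = G.R := rfl
/-- `Q.A = A`. [cite: NewmanTassionWu2017, §3.2 (Theorem 3.7)] -/
theorem Q_A : G.Q.A = G.A := rfl
/-- `Q.B = B`. [cite: NewmanTassionWu2017, §3.2 (Theorem 3.7)] -/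
theorem Q_B : G.Q.B = G.B := rfl
/-- `Q.C = C`. [cite: NewmanTassionWu2017, §3.2 (Theorem 3.7)] -/
theorem Q_C : G.Q.C = G.C := rfl

/-- A point of `R` within `ρ` of a vertex of `Γ ⊆ S̄` satisfies `a ≤ z.1 ≤ b`, `c - ρ ≤ z.2 ≤ d`.
[cite: NewmanTassionWu2017, §3.2 (proof of Theorem 3.7, step (1))] -/
theorem contact_bounds {ω : BondConfig (slab 3 k)} {ρ : ℕ} (hA : ω ∈ G.Q.evAB k) {z : ℤ × ℤ}
    (hzR : z ∈ G.R) (hnear : Near k (G.Q.γ k ω) ρ z) :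
    G.a ≤ z.1 ∧ z.1 ≤ G.b ∧ G.c - ρ ≤ z.2 ∧ z.2 ≤ G.d := by
  obtain ⟨hγO, -⟩ := G.Q.γ_spec hA
  obtain ⟨g, hg, hz⟩ := hnear
  have hgS : planar k g ∈ G.S := hγO.subset g hg
  rw [mem_S_iff] at hgS
  rw [mem_R_iff, mem_S_iff, mem_V_iff] at hzR
  rw [mem_sqBox_iff'] at hz
  have := G.ha'b; have := G.hcd
  omega

end LobeSetup

/-! ## The plain surgery with a rectangular cleared box `(z + B_r) ∩ S` -/

section PlainS

variable {G : LobeSetup} {ω : BondConfig (slab 3 k)} {ρ : ℕ}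

/-- **Plain surgery, cleared box inside `S`**: given port data whose far endpoint `u` lies over `S` (so the
far path enters the box `(z + B_{ρ+3}) ∩ S`), no cell of `A` within `ρ + 3` of `z = planar v` and the
box off the column `x = a`, there is a surgery whose cleared set is inside `z + B_{ρ+3}`.
[cite: NewmanTassionWu2017, §3.2 (proof of Theorem 3.7, steps (1)–(3); Fact 2, ω^{(z)})] -/
theorem exists_surgery_lobe_at_S (hk : 1 ≤ k) (hρ : 2 ≤ ρ) (hω : ω ⊆ (slabGraph 3 k).edgeSet)
    (hX : ω ∈ G.Q.evX k) {c₀ u v : slab 3 k} {L : List (slab 3 k)} (hc₀ : c₀ ∈ slabLift k G.C)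
    (hL : IsOSAP k ω (slabLift k G.R ∩ {x | ¬Near k (G.Q.γ k ω) ρ (planar k x)}) {c₀} {u} L)
    (huv : (slabGraph 3 k).Adj u v) (hvR : v ∈ slabLift k G.R) (huS : u ∈ slabLift k G.S)
    (hnear : Near k (G.Q.γ k ω) ρ (planar k v))
    (hnA : ∀ a' ∈ G.A, a' ∉ sqBox (planar k v) (ρ + 3))
    (hnC : ∀ c' ∈ G.C, c' ∉ sqBox (planar k v) (ρ + 3))
    (hnB : G.a + 1 ≤ (planar k v).1 - (ρ + 3)) :
    ∃ sx : G.Q.Surgery k ω, sx.D ⊆ sqBox (planar k v) (ρ + 3) := by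
  have hA : ω ∈ G.Q.evAB k := hX.1
  obtain ⟨hγO, -⟩ := G.Q.γ_spec hA
  set z := planar k v with hzdef
  set r : ℕ := ρ + 3 with hrdef
  set D := G.DS z r with hDdef
  have hzR : z ∈ G.R := hvR
  obtain ⟨hz1, hz2, hz3, hz4⟩ := LobeSetup.contact_bounds hA hzR hnear
  have hab := G.hab; have hcd := G.hcd
  have hDz : D ⊆ sqBox z (ρ + 3) := LobeSetup.DS_subset_sqBox _ _
  have hc₀D : planar k c₀ ∉ D := fun h => hnC _ hc₀ (hDz h)
  have hDA : ∀ w ∈ D, w ∉ G.Q.A := fun w hw hwA => hnA w hwA (hDz hw)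
  have hDB : ∀ w ∈ D, w ∉ G.Q.B := by
    intro w hw hwB
    have h1 := (mem_sqBox_iff'.1 (hDz hw)).1
    have h2 := (LobeSetup.mem_B_iff.1 hwB).2
    push_cast at h1 hnB; omega
  have hrows : max G.c (z.2 - (r : ℕ)) + 3 ≤ min G.d (z.2 + (r : ℕ)) := by
    simp only [max_add, le_min_iff, max_le_iff]; omega
  -- the port
  have huL : u ∈ L := by
    have := hL.last_mem hL.ne_nil
    rw [Set.mem_singleton_iff] at this
    rw [← this]; exact List.getLast_mem _
  have huD : planar k u ∈ D := by
    refine LobeSetup.mem_DS_iff.2 ⟨huS, sqBox_mono _ (by omega : 1 ≤ r) ?_⟩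
    exact planar_mem_sqBox_one_of_adj huv.symm
  have hheadL : L.head hL.ne_nil = c₀ := by
    have := hL.head_mem hL.ne_nil
    rwa [Set.mem_singleton_iff] at this
  have hheadD : planar k (L.head hL.ne_nil) ∉ D := by rw [hheadL]; exact hc₀D
  obtain ⟨m, w', rest, hm, hLeq, hmD, hw'D, hedge, -, hmhead, hconn, -⟩ :=
    exists_entry (R := G.R) hL.chain hL.nodup (fun x hx => (hL.subset x hx).1) hL.ne_nil hheadD
      ⟨u, huL, huD⟩
  rw [hheadL] at hconn
  set q₁ := m.getLast hm with hq₁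
  have hadj : (slabGraph 3 k).Adj w' q₁ := ((SimpleGraph.mem_edgeSet _).1 (hω hedge)).symm
  have hq₁D : planar k q₁ ∉ D := hmD _ (List.getLast_mem hm)
  have hσ : ω ∈ openConnIn (slabLift k (G.Q.R \ D)) q₁ c₀ := openConnIn_reverse hconn
  have hw'L : w' ∈ L := by rw [hLeq]; simp
  have hw'far : ¬Near k (G.Q.γ k ω) ρ (planar k w') := (hL.subset w' hw'L).2
  -- two vertices of `γ` over `D`
  obtain ⟨g₀, hg₀, hz⟩ := hnear
  have hg₀z : planar k g₀ ∈ sqBox z ρ := GlueGeom.mem_sqBox_comm hz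
  have hg₀h := ne_head_of_far_A (Q := G.Q) hA hz (by omega : ρ ≤ ρ + 3) hnA
  obtain ⟨g₁, hg₁γ, hadj₀, hg₁ne, -⟩ := exists_pred hω hA hg₀ hg₀h
  have hg₀D : planar k g₀ ∈ D :=
    LobeSetup.mem_DS_iff.2 ⟨hγO.subset g₀ hg₀, sqBox_mono _ (by omega) hg₀z⟩
  have hg₁D : planar k g₁ ∈ D := by
    refine LobeSetup.mem_DS_iff.2 ⟨hγO.subset g₁ hg₁γ, sqBox_mono _ (by omega : ρ + 1 ≤ r) ?_⟩
    exact mem_sqBox_add hg₀z (planar_mem_sqBox_one_of_adj hadj₀.symm)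
  have htwo : ∃ x ∈ G.Q.γ k ω, ∃ y ∈ G.Q.γ k ω, x ≠ y ∧ planar k x ∈ D ∧ planar k y ∈ D :=
    ⟨g₁, hg₁γ, g₀, hg₀, hg₁ne, hg₁D, hg₀D⟩
  have hroute : ∀ E₁ E₂ : slab 3 k, E₁ ∈ G.Q.γ k ω → E₂ ∈ G.Q.γ k ω → E₁ ≠ E₂ →
      planar k E₁ ∈ D → planar k E₂ ∈ D → ∃ Lr Br c, RouteSpec k D D E₁ E₂ w' Lr Br c := by
    intro E₁ E₂ hE₁ hE₂ hne hE₁D hE₂D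
    have h1 : ¬Near k (G.Q.γ k ω) 0 (planar k w') := fun hn => hw'far (hn.mono (by omega))
    exact exists_route (xL := max G.a (z.1 - (r : ℕ)))
      (xR' := min G.b (z.1 + (r : ℕ))) (xR := min G.b (z.1 + (r : ℕ)))
      (rB := max G.c (z.2 - (r : ℕ))) (rP := min G.d (z.2 + (r : ℕ))) (rT := min G.d (z.2 + (r : ℕ)))
      hk (by omega) le_rfl hrows le_rfl hE₁D hE₂D hw'D hne
      (ne_planar_of_not_near h1 hE₁).symm (ne_planar_of_not_near h1 hE₂).symm
  obtain ⟨sx, hsx⟩ := exists_surgery_of_route (Q := G.Q) hX (D := D) (Dt := D)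
    ((LobeSetup.DS_subset_S _ _).trans G.S_subset_R) hDA hDB subset_rfl (LobeSetup.DS_subset_S _ _)
    htwo hadj hq₁D hc₀ hσ hroute
  exact ⟨sx, hsx ▸ hDz⟩

end PlainS

/-! ## The plain surgery with an L-shaped cleared box: ports in the lobe -/

section PlainR

variable {G : LobeSetup} {ω : BondConfig (slab 3 k)} {ρ : ℕ}

/-- **Plain surgery, cleared box `(z + B_{ρ+3}) ∩ R` (possibly L-shaped)**: box off the column `x = a`,
no cell of `A` within `ρ + 3`, and at least four columns of the box over the lobe (`z.1 - ρ ≤ a'`). The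
trunk is routed in `(z + B_{ρ+3}) ∩ S`; if the port of the far path lies in the lobe, the branch runs to
an anchor on the bottom row of the trunk box and continues by an exterior L-path through the lobe.
[cite: NewmanTassionWu2017, §3.2 (proof of Theorem 3.7, steps (1)–(3); Remark 2: rectilinear domains)] -/
theorem exists_surgery_lobe_at_R (hk : 1 ≤ k) (hρ : 2 ≤ ρ) (hω : ω ⊆ (slabGraph 3 k).edgeSet)
    (hX : ω ∈ G.Q.evX k) {c₀ u v : slab 3 k} {L : List (slab 3 k)} (hc₀ : c₀ ∈ slabLift k G.C)
    (hL : IsOSAP k ω (slabLift k G.R ∩ {x | ¬Near k (G.Q.γ k ω) ρ (planar k x)}) {c₀} {u} L)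
    (huv : (slabGraph 3 k).Adj u v) (hvR : v ∈ slabLift k G.R)
    (hnear : Near k (G.Q.γ k ω) ρ (planar k v))
    (hnA : ∀ a' ∈ G.A, a' ∉ sqBox (planar k v) (ρ + 3))
    (hnC : ∀ c' ∈ G.C, c' ∉ sqBox (planar k v) (ρ + 3))
    (hnB : G.a + 1 ≤ (planar k v).1 - (ρ + 3)) (hlobe : (planar k v).1 - ρ ≤ G.a') :
    ∃ sx : G.Q.Surgery k ω, sx.D ⊆ sqBox (planar k v) (ρ + 3) := by
  have hA : ω ∈ G.Q.evAB k := hX.1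
  obtain ⟨hγO, -⟩ := G.Q.γ_spec hA
  set z := planar k v with hzdef
  set r : ℕ := ρ + 3 with hrdef
  set D := G.DR z r with hDdef
  set K := G.DS z r with hKdef
  have hzR : z ∈ G.R := hvR
  obtain ⟨hz1, hz2, hz3, hz4⟩ := LobeSetup.contact_bounds hA hzR hnear
  have hab := G.hab; have hcd := G.hcd; have haa' := G.haa'; have ha'b := G.ha'b
  have hDz : D ⊆ sqBox z (ρ + 3) := LobeSetup.DR_subset_sqBox _ _
  have hKD : K ⊆ D := LobeSetup.DS_subset_DR _ _
  have hc₀D : planar k c₀ ∉ D := fun h => hnC _ hc₀ (hDz h)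
  have hDA : ∀ w ∈ D, w ∉ G.Q.A := fun w hw hwA => hnA w hwA (hDz hw)
  have hDB : ∀ w ∈ D, w ∉ G.Q.B := by
    intro w hw hwB
    have h1 := (mem_sqBox_iff'.1 (hDz hw)).1
    have h2 := (LobeSetup.mem_B_iff.1 hwB).2
    push_cast at h1 hnB; omega
  have hrows : max G.c (z.2 - (r : ℕ)) + 3 ≤ min G.d (z.2 + (r : ℕ)) := by
    simp only [max_add, le_min_iff, max_le_iff]; omega
  -- membership criteria
  have memK : ∀ w : ℤ × ℤ, G.a ≤ w.1 → w.1 ≤ G.b → z.1 - r ≤ w.1 → w.1 ≤ z.1 + r →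
      G.c ≤ w.2 → w.2 ≤ G.d → z.2 - r ≤ w.2 → w.2 ≤ z.2 + r → w ∈ K := by
    intro w h1 h2 h3 h4 h5 h6 h7 h8
    rw [LobeSetup.mem_DS_iff, LobeSetup.mem_S_iff, mem_sqBox_iff']
    exact ⟨⟨h1, h2, h5, h6⟩, ⟨h3, h4, h7, h8⟩⟩
  have memDV : ∀ w : ℤ × ℤ, G.a ≤ w.1 → w.1 ≤ G.a' → z.1 - r ≤ w.1 → w.1 ≤ z.1 + r →
      G.c' ≤ w.2 → w.2 ≤ G.c - 1 → z.2 - r ≤ w.2 → w.2 ≤ z.2 + r → w ∈ D := by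
    intro w h1 h2 h3 h4 h5 h6 h7 h8
    refine LobeSetup.DV_subset_DR _ _ ?_
    rw [LobeSetup.mem_DV_iff, LobeSetup.mem_V_iff, mem_sqBox_iff']
    exact ⟨⟨h1, h2, h5, h6⟩, ⟨h3, h4, h7, h8⟩⟩
  have notK_low : ∀ w : ℤ × ℤ, w.2 ≤ G.c - 1 → w ∉ K := by
    intro w hw h
    have := (LobeSetup.mem_S_iff.1 (LobeSetup.mem_DS_iff.1 h).1).2.2.1
    omega
  -- the port
  have huL : u ∈ L := by
    have := hL.last_mem hL.ne_nil
    rw [Set.mem_singleton_iff] at this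
    rw [← this]; exact List.getLast_mem _
  have huD : planar k u ∈ D := by
    refine LobeSetup.mem_DR_iff.2 ⟨(hL.subset u huL).1, sqBox_mono _ (by omega : 1 ≤ r) ?_⟩
    exact planar_mem_sqBox_one_of_adj huv.symm
  have hheadL : L.head hL.ne_nil = c₀ := by
    have := hL.head_mem hL.ne_nil
    rwa [Set.mem_singleton_iff] at this
  have hheadD : planar k (L.head hL.ne_nil) ∉ D := by rw [hheadL]; exact hc₀D
  obtain ⟨m, w', rest, hm, hLeq, hmD, hw'D, hedge, -, hmhead, hconn, -⟩ :=
    exists_entry (R := G.R) hL.chain hL.nodup (fun x hx => (hL.subset x hx).1) hL.ne_nil hheadD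
      ⟨u, huL, huD⟩
  rw [hheadL] at hconn
  set q₁ := m.getLast hm with hq₁
  have hadj : (slabGraph 3 k).Adj w' q₁ := ((SimpleGraph.mem_edgeSet _).1 (hω hedge)).symm
  have hq₁D : planar k q₁ ∉ D := hmD _ (List.getLast_mem hm)
  have hσ : ω ∈ openConnIn (slabLift k (G.Q.R \ D)) q₁ c₀ := openConnIn_reverse hconn
  have hw'L : w' ∈ L := by rw [hLeq]; simp
  have hw'far : ¬Near k (G.Q.γ k ω) ρ (planar k w') := (hL.subset w' hw'L).2
  -- two vertices of `γ` over `K ⊆ D`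
  obtain ⟨g₀, hg₀, hz⟩ := hnear
  have hg₀z : planar k g₀ ∈ sqBox z ρ := GlueGeom.mem_sqBox_comm hz
  have hg₀h := ne_head_of_far_A (Q := G.Q) hA hz (by omega : ρ ≤ ρ + 3) hnA
  obtain ⟨g₁, hg₁γ, hadj₀, hg₁ne, -⟩ := exists_pred hω hA hg₀ hg₀h
  have hg₀D : planar k g₀ ∈ D :=
    hKD (LobeSetup.mem_DS_iff.2 ⟨hγO.subset g₀ hg₀, sqBox_mono _ (by omega) hg₀z⟩)
  have hg₁D : planar k g₁ ∈ D := by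
    refine hKD (LobeSetup.mem_DS_iff.2 ⟨hγO.subset g₁ hg₁γ, sqBox_mono _ (by omega : ρ + 1 ≤ r) ?_⟩)
    exact mem_sqBox_add hg₀z (planar_mem_sqBox_one_of_adj hadj₀.symm)
  have htwo : ∃ x ∈ G.Q.γ k ω, ∃ y ∈ G.Q.γ k ω, x ≠ y ∧ planar k x ∈ D ∧ planar k y ∈ D :=
    ⟨g₁, hg₁γ, g₀, hg₀, hg₁ne, hg₁D, hg₀D⟩
  have hγK : ∀ x ∈ G.Q.γ k ω, planar k x ∈ D → planar k x ∈ K := fun x hx hxD =>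
    LobeSetup.mem_DS_iff.2 ⟨hγO.subset x hx, hDz hxD⟩
  -- routing
  have hroute : ∀ E₁ E₂ : slab 3 k, E₁ ∈ G.Q.γ k ω → E₂ ∈ G.Q.γ k ω → E₁ ≠ E₂ →
      planar k E₁ ∈ D → planar k E₂ ∈ D → ∃ Lr Br c, RouteSpec k K D E₁ E₂ w' Lr Br c := by
    intro E₁ E₂ hE₁ hE₂ hne hE₁D hE₂D
    have hE₁K := hγK E₁ hE₁ hE₁D
    have hE₂K := hγK E₂ hE₂ hE₂D
    have h0 : ¬Near k (G.Q.γ k ω) 0 (planar k w') := fun hn => hw'far (hn.mono (by omega))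
    rcases LobeSetup.mem_DR_iff.1 hw'D with ⟨hw'R, hw'box⟩
    by_cases hw'S : planar k w' ∈ G.S
    · -- the port lies over the trunk box: route directly
      have hw'K : planar k w' ∈ K := LobeSetup.mem_DS_iff.2 ⟨hw'S, hw'box⟩
      obtain ⟨Lr, Br, c, spec⟩ := exists_route (xL := max G.a (z.1 - (r : ℕ)))
        (xR' := min G.b (z.1 + (r : ℕ))) (xR := min G.b (z.1 + (r : ℕ)))
        (rB := max G.c (z.2 - (r : ℕ))) (rP := min G.d (z.2 + (r : ℕ))) (rT := min G.d (z.2 + (r : ℕ)))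
        hk (by omega) le_rfl hrows le_rfl hE₁K hE₂K hw'K hne
        (ne_planar_of_not_near h0 hE₁).symm (ne_planar_of_not_near h0 hE₂).symm
      exact ⟨Lr, Br, c, RouteSpec.mono spec subset_rfl hKD⟩
    · -- the port lies in the lobe: anchor on the bottom row `c` of the trunk box, exterior L-path
      have hw'V : planar k w' ∈ G.V := (LobeSetup.mem_R_iff.1 hw'R).resolve_left hw'S
      set ew := planar k w' with hewdef
      have hew := LobeSetup.mem_V_iff.1 hw'V
      have hewbox := mem_sqBox_iff'.1 hw'box
      set e₁ := planar k E₁ with he₁def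
      set e₂ := planar k E₂ with he₂def
      set h : ℕ := ht w' with hhdef
      have hhk : h ≤ k := ht_le w'
      -- the anchor column: four columns `z.1 - r … z.1 - r + 3` over the lobe, avoid `e₁.1`, `e₂.1`
      obtain ⟨xa, hxa1, hxa2, hxae₁, hxae₂, -⟩ :=
        exists_row_avoid (rB := z.1 - r) (rP := z.1 - r + 3) (by omega) e₁.1 e₂.1 e₁.1
      set w'' : slab 3 k := vtx k (xa, G.c) h with hw''def
      have hw''p : planar k w'' = (xa, G.c) := planar_vtx _ _
      have hw''K : planar k w'' ∈ K := by
        rw [hw''p]; refine memK _ ?_ ?_ ?_ ?_ ?_ ?_ ?_ ?_ <;> dsimp only <;> omega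
      have hE₁w'' : planar k E₁ ≠ planar k w'' := by
        intro hE; have := congrArg Prod.fst hE; rw [hw''p] at this; exact hxae₁ this.symm
      have hE₂w'' : planar k E₂ ≠ planar k w'' := by
        intro hE; have := congrArg Prod.fst hE; rw [hw''p] at this; exact hxae₂ this.symm
      obtain ⟨Lr, Br, c, spec⟩ := exists_route (xL := max G.a (z.1 - (r : ℕ)))
        (xR' := min G.b (z.1 + (r : ℕ))) (xR := min G.b (z.1 + (r : ℕ)))
        (rB := max G.c (z.2 - (r : ℕ))) (rP := min G.d (z.2 + (r : ℕ))) (rT := min G.d (z.2 + (r : ℕ)))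
        hk (by omega) le_rfl hrows le_rfl hE₁K hE₂K hw''K hne hE₁w'' hE₂w''
      have spec' : RouteSpec k K D E₁ E₂ w'' Lr Br c := RouteSpec.mono spec subset_rfl hKD
      -- the exterior L-path from `(xa, c-1)` to `ew`, at height `h`
      obtain ⟨lp, hlp, hlpmem⟩ := exists_lpath_hv ((xa, G.c - 1) : ℤ × ℤ) ew
      set X : List (slab 3 k) := liftH k h lp with hXdef
      have hXne : X ≠ [] := liftH_ne_nil hlp.ne_nil
      have hXlow : ∀ x ∈ X, (planar k x).2 ≤ G.c - 1 ∧ ht x = h := by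
        intro x hx
        rw [hXdef, mem_liftH_iff hhk] at hx
        refine ⟨?_, hx.2⟩
        rcases (hlpmem _).1 hx.1 with ⟨h1, -, -⟩ | ⟨-, -, h3⟩
        · simp only at h1; omega
        · simp only at h3; rw [max_def] at h3; split_ifs at h3 <;> omega
      have hXK : ∀ x ∈ X, planar k x ∉ K := fun x hx => notK_low _ (hXlow x hx).1
      have hXD : ∀ x ∈ X, planar k x ∈ D := by
        intro x hx
        rw [hXdef, mem_liftH_iff hhk] at hx
        rcases (hlpmem _).1 hx.1 with ⟨h1, h2, h3⟩ | ⟨h1, h2, h3⟩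
        · simp only at h1 h2 h3
          refine memDV _ ?_ ?_ ?_ ?_ ?_ ?_ ?_ ?_ <;>
            · rw [min_def] at h2; rw [max_def] at h3; split_ifs at h2 h3 <;> push_cast at * <;> omega
        · simp only at h1 h2 h3
          refine memDV _ ?_ ?_ ?_ ?_ ?_ ?_ ?_ ?_ <;>
            · rw [min_def] at h2; rw [max_def] at h3; split_ifs at h2 h3 <;> push_cast at * <;> omega
      have hXhead : X.head? = some (vtx k (xa, G.c - 1) h) := by
        rw [hXdef, head?_liftH, hlp.head]; rfl
      have hXlast : X.getLast hXne = w' := by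
        apply Option.some_injective
        rw [← List.getLast?_eq_some_getLast, hXdef, getLast?_liftH, hlp.last]
        simp [hewdef, hhdef, vtx_planar_ht]
      have hchX : (w'' :: X).IsChain (fun a b => (slabGraph 3 k).Adj a b) := by
        rw [List.isChain_cons]
        refine ⟨fun y hy => ?_, liftH_isChain h hlp.chain⟩
        rw [hXhead] at hy
        simp only [Option.mem_def, Option.some.injEq] at hy
        rw [← hy, hw''def]
        refine vtx_adj_vtx_planar ?_ h
        simp only [planarAdj, Prod.mk_add_mk, Prod.mk.injEq]
        omega
      have hXL : ∀ x ∈ X, x ∉ Lr := fun x hx hm => hXK x hx (spec.hL_sub x hm)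
      have hXBr : ∀ x ∈ X, x ∉ c :: Br := by
        intro x hx hm
        rcases List.mem_cons.1 hm with hm | hm
        · exact hXK x hx (hm ▸ spec.hL_sub c spec.hc)
        · exact hXK x hx (spec.hBr_sub x hm)
      have spec₂ := RouteSpec.append_branch X w'' Br hXne spec' hchX (liftH_nodup hlp.nodup) hXL hXBr hXD
      rw [hXlast] at spec₂
      exact ⟨Lr, Br ++ X, c, spec₂⟩
  obtain ⟨sx, hsx⟩ := exists_surgery_of_route (Q := G.Q) hX (D := D) (Dt := K)
    (LobeSetup.DR_subset_R _ _) hDA hDB hKD (LobeSetup.DS_subset_S _ _) htwo hadj hq₁D hc₀ hσ hroute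
  exact ⟨sx, hsx ▸ hDz⟩

end PlainR

end NTW17

end Literature.Probability.Percolation

end
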